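import Literature.MathematicalPhysics.QuantumLattice.GermMarkovSpectralCriterionSpectral
import Literature.Analysis.Fourier.TitchmarshFourierSpectrumMul
import HarnessLib

/-!
# Rozanov's spectral criterion, proof part III: necessity (`InvSpectralDensityPolynomialOfCollarMarkov`)

Topic `MathematicalPhysics/QuantumLattice`; discharges the named fact
`InvSpectralDensityPolynomialOfCollarMarkov` of `GermMarkovSpectralCriterion` (Yu. A. Rozanov,
*Markov Random Fields* (1982), Ch. 3 §2.3 Theorem, necessity half: a stationary generalised
Gaussian field on `ℝᵈ` which is Markov — in Rozanov's collar sense — with respect to all balls has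
a spectral density whose inverse is a polynomial).  THEOREM-ONLY file.

The argument, following Rozanov Ch. 3 §2.3 with parts I–II
(`GermMarkovSpectralCriterionSplitting`, `GermMarkovSpectralCriterionSpectral`):

1. (`re_integral_inv_mul_fourier_eq_zero`) Fix `R > 0` and a real test function `v` supported
   off `B(0, R)`.  With `r = R/2` and a collar width `ε < ε₀(r)`, `ε ≤ R/4`, part II gives
   `Re ∫ conj(û) v̂ / φ = 0` for every real `u` supported in `B̄(0, r - ε)`; letting `u` run
   through normalised bumps `uₙ` shrinking to `δ₀` (`ûₙ → 1` boundedly, dominated convergence)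
   yields `Re ∫ v̂ / φ = 0` — Rozanov's "the dual field `ξ*` with spectral density `1/φ` has
   `⟪ξ*_u, ξ*_v⟫ = 0` for `supp u`, `supp v` separated by a collar".
2. (`integral_inv_mul_fourier_ofRealTest_eq_zero`, `integral_inv_mul_fourier_eq_zero_of_real`)
   Evenness of `φ` and Hermitian symmetry make `∫ v̂ / φ` real for real `v`, hence zero, and
   complex test functions split into real and imaginary parts.
3. (`integral_ofReal_inv_mul_fourierInv_eq_zero`) `𝓕⁻ w (ξ) = 𝓕 w (-ξ)` and evenness turn
   this into the vanishing of the tempered distribution `𝓕⁻(1/φ)` on all test functions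
   supported off any ball around `0`, i.e. `supp 𝓕⁻(1/φ) ⊆ {0}`.
4. (`InvSpectralDensityPolynomialOfCollarMarkov_holds`) The Fourier-support-at-zero theorem
   `Literature.Analysis.Distribution.ae_eq_mvPolynomial_of_forall_integral_fourierInv_eq_zero`
   (a temperate function whose inverse Fourier transform is supported at the origin is a.e. a
   polynomial — Rozanov's closing step "a generalised function supported at `0` is a finite
   combination of derivatives of `δ`, so `1/φ` is a polynomial") concludes.

## References

* Yu. A. Rozanov, *Markov Random Fields*, Springer (1982), Ch. 3 §2.3 Theorem (necessity),
  §1.3 (1.22)–(1.26). [Rozanov1982]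

## Mathlib / tree

`ContDiffBump.normed` (`integral_normed`, `tsupport_normed_eq`, `support_normed_eq`),
`HasCompactSupport.toSchwartzMap`, `VectorFourier.norm_fourierIntegral_le_integral_norm`,
`tendsto_integral_of_dominated_convergence`, the tree's
`Literature.Analysis.Fourier.norm_fourierChar_sub_one_le` (`|𝐞(t) − 1| ≤ 2π|t|`),
`Real.fourierInv_eq_fourier_neg`, `integral_neg_eq_self`, `frontier_ball`, `closure_ball`; parts
I–II and `FourierSupportAtZeroPolynomial`.  No new definitions.
-/

noncomputable section

open MeasureTheory ProbabilityTheory Filter Metric Set Complex FourierTransform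
open scoped Topology InnerProductSpace ENNReal SchwartzMap ComplexConjugate Real
open Literature.Probability.Distributions Literature.Analysis.Distribution

namespace Literature.MathematicalPhysics.QuantumLattice

variable {V : Type*} [NormedAddCommGroup V] [InnerProductSpace ℝ V] [FiniteDimensional ℝ V]
  [MeasurableSpace V] [BorelSpace V]

/-! ### Normalised bumps as an approximate identity on the Fourier side -/

section Bump

/-- Normalised bumps are test functions. [folklore] -/
theorem exists_schwartz_eq_normed (χ : ContDiffBump (0 : V)) :
    ∃ u : 𝓢(V, ℝ), ∀ x, u x = χ.normed volume x :=
  ⟨(χ.hasCompactSupport_normed (μ := volume)).toSchwartzMap χ.contDiff_normed, fun _ => rfl⟩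

/-- The support of a normalised bump test function. [folklore] -/
theorem tsupport_subset_of_eq_normed (χ : ContDiffBump (0 : V)) {u : 𝓢(V, ℝ)}
    (hu : ∀ x, u x = χ.normed volume x) : tsupport u ⊆ closedBall 0 χ.rOut := by
  have h : (u : V → ℝ) = χ.normed volume := funext hu
  rw [h, χ.tsupport_normed_eq]

/-- `|ûδ| ≤ ∫ uδ = 1` for a normalised bump `uδ`. [folklore] -/
theorem norm_fourier_normed_le_one (χ : ContDiffBump (0 : V)) {u : 𝓢(V, ℝ)}
    (hu : ∀ x, u x = χ.normed volume x) (ξ : V) : ‖𝓕 (ofRealTest u) ξ‖ ≤ 1 := by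
  rw [SchwartzMap.fourier_coe]
  refine (VectorFourier.norm_fourierIntegral_le_integral_norm _ _ _ _ _).trans (le_of_eq ?_)
  have h : ∀ x, ‖(ofRealTest u) x‖ = χ.normed volume x := fun x => by
    rw [ofRealTest_apply, Complex.norm_real, hu, Real.norm_of_nonneg (χ.nonneg_normed x)]
  simp_rw [h, χ.integral_normed]

/-- `|ûδ(ξ) - 1| ≤ 2π δ |ξ|` for a normalised bump `uδ` supported in `B̄(0, δ)`:
`ûδ(ξ) - 1 = ∫ (e^{-2πi⟨x,ξ⟩} - 1) uδ(x) dx`. [folklore] -/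
theorem norm_fourier_normed_sub_one_le (χ : ContDiffBump (0 : V)) {u : 𝓢(V, ℝ)}
    (hu : ∀ x, u x = χ.normed volume x) (ξ : V) :
    ‖𝓕 (ofRealTest u) ξ - 1‖ ≤ 2 * π * χ.rOut * ‖ξ‖ := by
  have hint : Integrable (fun x => (ofRealTest u) x) := (ofRealTest u).integrable
  have hint' : Integrable (fun x => 𝐞 (-⟪x, ξ⟫_ℝ) • (ofRealTest u) x) :=
    (Real.fourierIntegral_convergent_iff ξ).2 hint
  have h1 : (1 : ℂ) = ∫ x, (ofRealTest u) x := by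
    simp_rw [ofRealTest_apply, hu]
    rw [integral_complex_ofReal, χ.integral_normed, Complex.ofReal_one]
  rw [SchwartzMap.fourier_coe, Real.fourier_eq, h1, ← integral_sub hint' hint]
  refine (norm_integral_le_integral_norm _).trans ?_
  have hbound : ∀ x, ‖𝐞 (-⟪x, ξ⟫_ℝ) • (ofRealTest u) x - (ofRealTest u) x‖ ≤
      (2 * π * χ.rOut * ‖ξ‖) * χ.normed volume x := by
    intro x
    rw [Circle.smul_def, smul_eq_mul, ← sub_one_mul, norm_mul, ofRealTest_apply, Complex.norm_real,
      hu, Real.norm_of_nonneg (χ.nonneg_normed x)]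
    by_cases hx : χ.normed volume x = 0
    · simp [hx]
    · have hxs : x ∈ ball (0 : V) χ.rOut := by
        rw [← χ.support_normed_eq (μ := volume)]; exact hx
      rw [mem_ball, dist_zero_right] at hxs
      refine mul_le_mul_of_nonneg_right ?_ (χ.nonneg_normed x)
      refine (Literature.Analysis.Fourier.norm_fourierChar_sub_one_le _).trans ?_
      rw [abs_neg]
      have hle : |⟪x, ξ⟫_ℝ| ≤ χ.rOut * ‖ξ‖ :=
        (abs_real_inner_le_norm x ξ).trans (mul_le_mul_of_nonneg_right hxs.le (norm_nonneg _))
      calc 2 * π * |⟪x, ξ⟫_ℝ| ≤ 2 * π * (χ.rOut * ‖ξ‖) :=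
            mul_le_mul_of_nonneg_left hle (by positivity)
        _ = 2 * π * χ.rOut * ‖ξ‖ := by ring
  calc ∫ x, ‖𝐞 (-⟪x, ξ⟫_ℝ) • (ofRealTest u) x - (ofRealTest u) x‖
      ≤ ∫ x, (2 * π * χ.rOut * ‖ξ‖) * χ.normed volume x :=
        integral_mono (hint'.sub hint).norm (χ.integrable_normed.const_mul _) hbound
    _ = 2 * π * χ.rOut * ‖ξ‖ := by rw [integral_const_mul, χ.integral_normed, mul_one]

end Bump

/-! ### Step 1: the approximate identity in the key identity (Rozanov Ch. 3 §2.3) -/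

section Limit

variable {φ : V → ℝ} {ν : Measure V} {μ : Measure (FieldConfig V)}

/-- **Rozanov Ch. 3 §2.3, necessity, real form.**  For the centred Gaussian field with even,
a.e. positive temperate spectral density `φ` (temperate inverse) which is collar-Markov at every
ball `B(0, r)`, and every real test function `v` supported off a ball `B(0, R)`:
`Re ∫ v̂(ξ) / φ(ξ) dξ = 0`.  (Key identity of part II for `u = uₙ` a normalised bump shrinking to
`δ₀`, then `n → ∞` by dominated convergence: `ûₙ → 1`, `|ûₙ| ≤ 1`.)
[cite: Rozanov1982, Ch. 3 §2.3 Theorem] -/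
theorem re_integral_inv_mul_fourier_eq_zero [IsProbabilityMeasure μ] (hμ : IsGaussianField μ)
    (hν : ν = (volume : Measure V).withDensity fun ξ => ENNReal.ofReal (φ ξ))
    (hφm : Measurable φ) (hφ0 : ∀ ξ, 0 ≤ φ ξ) (hφpos : ∀ᵐ ξ ∂(volume : Measure V), 0 < φ ξ)
    (hφev : ∀ ξ, φ (-ξ) = φ ξ) [ν.HasTemperateGrowth] [IsFiniteMeasureOnCompacts ν] {m' : ℕ}
    (hφinv : Integrable (fun ξ => (1 + ‖ξ‖ ^ 2) ^ (-(m' : ℝ)) * (φ ξ)⁻¹))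
    (hcovT : ∀ w w' : 𝓢(V, ℝ),
      ⟪(memLp_two_of_isGaussianProcess hμ.isGaussianProcess_eval w).toLp (fun ω : FieldConfig V => ω w),
          (memLp_two_of_isGaussianProcess hμ.isGaussianProcess_eval w').toLp
            (fun ω : FieldConfig V => ω w')⟫_ℝ =
        (⟪(𝓕 (ofRealTest w)).toLp 2 ν, (𝓕 (ofRealTest w')).toLp 2 ν⟫_ℂ).re)
    (hM : ∀ r : ℝ, 0 < r → IsCollarMarkovAt μ (ball (0 : V) r))
    {R : ℝ} (hR : 0 < R) {v : 𝓢(V, ℝ)} (hv : tsupport v ⊆ (ball (0 : V) R)ᶜ) :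
    (∫ ξ, ((φ ξ : ℂ))⁻¹ * 𝓕 (ofRealTest v) ξ).re = 0 := by
  -- the collar: `r = R/2`, `ε = min (ε₀/2) (R/4)`
  obtain ⟨ε₀, hε₀, hM'⟩ := hM (R / 2) (by positivity)
  set r := R / 2 with hr
  have hr0 : 0 < r := by positivity
  set ε := min (ε₀ / 2) (R / 4) with hεdef
  have hε : 0 < ε := lt_min (by positivity) (by positivity)
  have hεε₀ : ε < ε₀ := (min_le_left _ _).trans_lt (by linarith)
  have hεR : ε ≤ R / 4 := min_le_right _ _
  have hεr : ε < r := by rw [hr]; linarith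
  have hrε : r + ε ≤ R := by rw [hr]; linarith
  have hCI : CondIndepCondExp (fieldSigma (thickening ε (sphere (0 : V) r)))
      (fieldSigma (ball (0 : V) r)) (fieldSigma (closedBall (0 : V) r)ᶜ) μ := by
    have h := hM' ε hε hεε₀
    rwa [frontier_ball (0 : V) hr0.ne', closure_ball (0 : V) hr0.ne'] at h
  have hv' : tsupport v ⊆ (ball (0 : V) (r + ε))ᶜ :=
    hv.trans (compl_subset_compl.2 (ball_subset_ball hrε))
  -- the bumps `uₙ`, supported in `B̄(0, (r - ε)/(n+1)) ⊆ B̄(0, r - ε)`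
  have hδ : ∀ n : ℕ, 0 < (r - ε) / ((n : ℝ) + 1) := fun n => div_pos (by linarith) (by positivity)
  set χ : ℕ → ContDiffBump (0 : V) := fun n =>
    ⟨(r - ε) / ((n : ℝ) + 1) / 2, (r - ε) / ((n : ℝ) + 1), by linarith [hδ n], by linarith [hδ n]⟩
    with hχ
  choose u hu using fun n => exists_schwartz_eq_normed (V := V) (χ n)
  have hsupp : ∀ n, tsupport (u n) ⊆ closedBall (0 : V) (r - ε) := fun n =>
    (tsupport_subset_of_eq_normed (χ n) (hu n)).trans
      (closedBall_subset_closedBall (div_le_self (by linarith) (by linarith)))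
  have hkey : ∀ n, (∫ ξ, ((φ ξ : ℂ))⁻¹ *
      (conj (𝓕 (ofRealTest (u n)) ξ) * 𝓕 (ofRealTest v) ξ)).re = 0 := fun n =>
    re_integral_inv_mul_conj_fourier_mul_fourier_eq_zero hμ hν hφm hφ0 hφpos hφev hφinv hcovT
      hε hεr hCI (hsupp n) hv'
  -- dominated convergence
  obtain ⟨S, hS⟩ := (𝓕 (ofRealTest v)).exists_one_add_pow_mul_norm_le (2 * m')
  have hdom : Integrable (fun ξ => (((φ ξ)⁻¹ : ℝ) : ℂ) * 𝓕 (ofRealTest v) ξ) :=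
    integrable_ofReal_mul_of_decay (ψ := fun ξ => (φ ξ)⁻¹) hφm.inv hφinv
      (𝓕 (ofRealTest v)).continuous hS
  have hlim : Tendsto (fun n => ∫ ξ, ((φ ξ : ℂ))⁻¹ *
      (conj (𝓕 (ofRealTest (u n)) ξ) * 𝓕 (ofRealTest v) ξ)) atTop
      (𝓝 (∫ ξ, ((φ ξ : ℂ))⁻¹ * 𝓕 (ofRealTest v) ξ)) := by
    refine tendsto_integral_of_dominated_convergence
      (fun ξ => ‖(((φ ξ)⁻¹ : ℝ) : ℂ) * 𝓕 (ofRealTest v) ξ‖) (fun n => ?_) hdom.norm (fun n => ?_) ?_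
    · exact ((Complex.measurable_ofReal.comp hφm).inv.mul
        (((Complex.continuous_conj.comp (𝓕 (ofRealTest (u n))).continuous).mul
          (𝓕 (ofRealTest v)).continuous).measurable)).aestronglyMeasurable
    · refine Eventually.of_forall fun ξ => ?_
      rw [norm_mul, norm_mul, norm_mul, Complex.ofReal_inv, Complex.norm_conj]
      refine mul_le_mul_of_nonneg_left ?_ (norm_nonneg _)
      exact mul_le_of_le_one_left (norm_nonneg _) (norm_fourier_normed_le_one (χ n) (hu n) ξ)
    · refine Eventually.of_forall fun ξ => ?_
      have h1 : Tendsto (fun n => 𝓕 (ofRealTest (u n)) ξ) atTop (𝓝 1) := by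
        refine tendsto_iff_norm_sub_tendsto_zero.2 ?_
        refine squeeze_zero (fun n => norm_nonneg _)
          (fun n => norm_fourier_normed_sub_one_le (χ n) (hu n) ξ) ?_
        have h : Tendsto (fun n : ℕ => 2 * π * ((r - ε) * (1 / ((n : ℝ) + 1))) * ‖ξ‖) atTop
            (𝓝 (2 * π * ((r - ε) * 0) * ‖ξ‖)) :=
          ((tendsto_one_div_add_atTop_nhds_zero_nat.const_mul (r - ε)).const_mul
            (2 * π)).mul_const ‖ξ‖
        rw [mul_zero, mul_zero, zero_mul] at h
        refine h.congr fun n => ?_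
        rw [hχ, mul_one_div]
      have h2 : Tendsto (fun n => conj (𝓕 (ofRealTest (u n)) ξ)) atTop (𝓝 (conj (1 : ℂ))) :=
        (Complex.continuous_conj.tendsto 1).comp h1
      rw [map_one] at h2
      have h3 := (h2.mul_const (𝓕 (ofRealTest v) ξ)).const_mul ((φ ξ : ℂ))⁻¹
      rw [one_mul] at h3
      simpa only [Complex.ofReal_inv] using h3
  have hre : Tendsto (fun n => (∫ ξ, ((φ ξ : ℂ))⁻¹ *
      (conj (𝓕 (ofRealTest (u n)) ξ) * 𝓕 (ofRealTest v) ξ)).re) atTop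
      (𝓝 (∫ ξ, ((φ ξ : ℂ))⁻¹ * 𝓕 (ofRealTest v) ξ).re) :=
    (Complex.continuous_re.tendsto _).comp hlim
  simp only [hkey] at hre
  exact tendsto_nhds_unique hre tendsto_const_nhds

end Limit

/-! ### Steps 2–3: reality, complexification, inversion -/

section Complex

variable {φ : V → ℝ}

/-- For an even density and a real test function `v`, `∫ v̂ / φ` is real; so it vanishes as soon
as its real part does. [cite: Rozanov1982, Ch. 3 §2.3] -/
theorem integral_inv_mul_fourier_ofRealTest_eq_zero (hφev : ∀ ξ, φ (-ξ) = φ ξ) {v : 𝓢(V, ℝ)}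
    (h : (∫ ξ, ((φ ξ : ℂ))⁻¹ * 𝓕 (ofRealTest v) ξ).re = 0) :
    ∫ ξ, ((φ ξ : ℂ))⁻¹ * 𝓕 (ofRealTest v) ξ = 0 := by
  have hreal : conj (∫ ξ, ((φ ξ : ℂ))⁻¹ * 𝓕 (ofRealTest v) ξ) =
      ∫ ξ, ((φ ξ : ℂ))⁻¹ * 𝓕 (ofRealTest v) ξ := by
    rw [← integral_conj]
    conv_rhs => rw [← integral_neg_eq_self]
    congr 1 with ξ
    simp only [map_mul, map_inv₀, Complex.conj_ofReal, hφev, conj_fourier_ofRealTest]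
  apply Complex.ext
  · simpa using h
  · rw [Complex.zero_im]
    exact Complex.conj_eq_iff_im.1 hreal

/-- Complex test functions: if `∫ v̂ / φ = 0` for all real `v` supported off `B(0, R)` then
`∫ ŵ / φ = 0` for all complex `w` supported off `B(0, R)` (`w = Re w + i Im w`).
[cite: Rozanov1982, Ch. 3 §2.3] -/
theorem integral_inv_mul_fourier_eq_zero_of_real (hφm : Measurable φ) {m' : ℕ}
    (hφinv : Integrable (fun ξ => (1 + ‖ξ‖ ^ 2) ^ (-(m' : ℝ)) * (φ ξ)⁻¹)) {R : ℝ}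
    (h : ∀ v : 𝓢(V, ℝ), tsupport v ⊆ (ball (0 : V) R)ᶜ →
      ∫ ξ, ((φ ξ : ℂ))⁻¹ * 𝓕 (ofRealTest v) ξ = 0)
    {w : 𝓢(V, ℂ)} (hw : tsupport w ⊆ (ball (0 : V) R)ᶜ) :
    ∫ ξ, ((φ ξ : ℂ))⁻¹ * 𝓕 w ξ = 0 := by
  have hdec : 𝓕 w = 𝓕 (ofRealTest (reTest w)) + (I : ℂ) • 𝓕 (ofRealTest (imTest w)) := by
    rw [← FourierSMul.fourier_smul, ← FourierAdd.fourier_add]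
    congr 1
    ext x
    simp only [add_apply, smul_apply, ofRealTest_apply, reTest_apply, imTest_apply, smul_eq_mul]
    rw [mul_comm, Complex.re_add_im]
  have hint : ∀ v : 𝓢(V, ℝ), Integrable (fun ξ => ((φ ξ : ℂ))⁻¹ * 𝓕 (ofRealTest v) ξ) := by
    intro v
    obtain ⟨S, hS⟩ := (𝓕 (ofRealTest v)).exists_one_add_pow_mul_norm_le (2 * m')
    have hi : Integrable (fun ξ => (((φ ξ)⁻¹ : ℝ) : ℂ) * 𝓕 (ofRealTest v) ξ) :=
      integrable_ofReal_mul_of_decay (ψ := fun ξ => (φ ξ)⁻¹) hφm.inv hφinv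
        (𝓕 (ofRealTest v)).continuous hS
    simpa only [Complex.ofReal_inv] using hi
  calc ∫ ξ, ((φ ξ : ℂ))⁻¹ * 𝓕 w ξ
      = ∫ ξ, (((φ ξ : ℂ))⁻¹ * 𝓕 (ofRealTest (reTest w)) ξ +
          I * (((φ ξ : ℂ))⁻¹ * 𝓕 (ofRealTest (imTest w)) ξ)) := by
        congr 1 with ξ
        rw [hdec]
        simp only [add_apply, smul_apply, smul_eq_mul]
        ring
    _ = (∫ ξ, ((φ ξ : ℂ))⁻¹ * 𝓕 (ofRealTest (reTest w)) ξ) +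
          I * ∫ ξ, ((φ ξ : ℂ))⁻¹ * 𝓕 (ofRealTest (imTest w)) ξ := by
        rw [integral_add (hint _) ((hint _).const_mul I), integral_const_mul]
    _ = 0 := by
        rw [h _ ((tsupport_reTest_subset w).trans hw), h _ ((tsupport_imTest_subset w).trans hw)]
        simp

/-- Inversion: `∫ (1/φ) 𝓕⁻ w = ∫ (1/φ) 𝓕 w` for an even density
(`𝓕⁻ w (ξ) = 𝓕 w (-ξ)` and `ξ ↦ -ξ` preserves Lebesgue measure). [folklore] -/
theorem integral_ofReal_inv_mul_fourierInv_eq_zero (hφev : ∀ ξ, φ (-ξ) = φ ξ) {w : 𝓢(V, ℂ)}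
    (h : ∫ ξ, ((φ ξ : ℂ))⁻¹ * 𝓕 w ξ = 0) :
    ∫ ξ, (((φ ξ)⁻¹ : ℝ) : ℂ) * 𝓕⁻ (w : V → ℂ) ξ = 0 := by
  calc ∫ ξ, (((φ ξ)⁻¹ : ℝ) : ℂ) * 𝓕⁻ (w : V → ℂ) ξ
      = ∫ ξ, ((φ (-ξ) : ℂ))⁻¹ * 𝓕 w (-ξ) := by
        congr 1 with ξ
        rw [Complex.ofReal_inv, hφev, Real.fourierInv_eq_fourier_neg]
        rfl
    _ = ∫ ξ, ((φ ξ : ℂ))⁻¹ * 𝓕 w ξ :=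
        integral_neg_eq_self (fun ξ => ((φ ξ : ℂ))⁻¹ * 𝓕 w ξ) volume
    _ = 0 := h

end Complex

/-! ### Step 4: assembly -/

/-- **Rozanov's theorem, necessity** (Yu. A. Rozanov, *Markov Random Fields* (1982), Ch. 3 §2.3
Theorem): discharge of the named fact `InvSpectralDensityPolynomialOfCollarMarkov` — a centred
stationary Gaussian generalised field on `ℝᵈ` with even, a.e. positive, temperate spectral
density `φ` (temperate inverse) which has Rozanov's collar Markov property at every open ball has
`1/φ` a.e. equal to a polynomial. [cite: Rozanov1982, Ch. 3 §2.3 Theorem] -/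
theorem InvSpectralDensityPolynomialOfCollarMarkov_holds :
    InvSpectralDensityPolynomialOfCollarMarkov := by
  intro d μ φ hprob hgauss hφm hφ0 hφpos hφev hφint hφinv hcov hM
  obtain ⟨m, hφint⟩ := hφint
  obtain ⟨m', hφinv⟩ := hφinv
  set ν : Measure (EuclideanSpace ℝ (Fin d)) :=
    (volume : Measure (EuclideanSpace ℝ (Fin d))).withDensity fun ξ => ENNReal.ofReal (φ ξ) with hν
  haveI : ν.HasTemperateGrowth := hasTemperateGrowth_withDensity_ofReal hφm hφ0 hφint
  haveI : IsFiniteMeasureOnCompacts ν := isFiniteMeasureOnCompacts_withDensity_ofReal hφm hφint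
  have hcovT := inner_toLp_eval_eq_re_inner hgauss.isGaussianProcess_eval hν hφm hφ0 hcov
  have hreal : ∀ R : ℝ, 0 < R → ∀ v : 𝓢(EuclideanSpace ℝ (Fin d), ℝ),
      tsupport v ⊆ (ball (0 : EuclideanSpace ℝ (Fin d)) R)ᶜ →
        ∫ ξ, ((φ ξ : ℂ))⁻¹ * 𝓕 (ofRealTest v) ξ = 0 :=
    fun R hR v hv => integral_inv_mul_fourier_ofRealTest_eq_zero hφev
      (re_integral_inv_mul_fourier_eq_zero hgauss hν hφm hφ0 hφpos hφev hφinv hcovT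
        (fun r hr => hM 0 r hr) hR hv)
  refine ae_eq_mvPolynomial_of_forall_integral_fourierInv_eq_zero (ψ := fun ξ => (φ ξ)⁻¹)
    (p := m') hφm.inv hφinv fun w R hR hw => ?_
  exact integral_ofReal_inv_mul_fourierInv_eq_zero hφev
    (integral_inv_mul_fourier_eq_zero_of_real hφm hφinv (hreal R hR) hw)

end Literature.MathematicalPhysics.QuantumLattice
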